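import Mathlib
import Literature.AlgebraicGeometry.Dimension.PointDimension

/-!
# Candidate proof of STUB 3 `stub_stableComponentsModular` (line `yoshida-divisor-selmer-count`,
crux stmt-Langlands-13639) — from the crux disprover (refuter-cdisprove-stmt-Langlands-13639-g3-0)

Sorry-free, axioms {propext, Classical.choice, Quot.sound}, `lean check` rc 0.

HOW TO USE (lead prover): in `Lines/yoshida-divisor-selmer-count.lean`
1. add `import Literature.AlgebraicGeometry.Dimension.PointDimension` (for
   `PrimeSpectrum.coe_coheight_eq_ringKrullDim_quotient : ↑(coheight p) = ringKrullDim (R ⧸ p)`);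
2. paste `exists_prime_ringKrullDim_quotient_eq_two` before the stub;
3. replace the `sorry` of `stub_stableComponentsModular` by the tactic block of
   `stub_stableComponentsModular` below (the statement here is the registered one verbatim, over a
   verbatim copy of `IsConnectedInDimTwo`).
`IsLocalRing R` is not used.  The only non-obvious step — a prime `P ⊇ 𝔮₁ ⊔ 𝔮₂` with
`ringKrullDim (R ⧸ P) = 2` EXACTLY — is Noetherian maximality among primes above `𝔮₁ ⊔ 𝔮₂` of
coheight `≥ 2` plus `Order.coheight_eq_coe_iff_maximal_le_coheight`; finiteness of `dim R` is not
needed.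
-/

set_option linter.dupNamespace false

open Order

namespace Summit.Langlands.Langlands.Cruxes.ResiduallyYoshidaLifting.StubStableComponentsModular

/-- VERBATIM copy of the skeleton's `IsConnectedInDimTwo`. -/
def IsConnectedInDimTwo (R : Type) [CommRing R] : Prop :=
  ∀ 𝒜 : Set (Ideal R), 𝒜 ⊆ minimalPrimes R → 𝒜.Nonempty → (minimalPrimes R \ 𝒜).Nonempty →
    ∃ 𝔮₁ ∈ 𝒜, ∃ 𝔮₂ ∈ minimalPrimes R \ 𝒜, (2 : WithBot ℕ∞) ≤ ringKrullDim (R ⧸ (𝔮₁ ⊔ 𝔮₂))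

/-- In a Noetherian ring, if `dim R/J ≥ 2` then some prime `P ⊇ J` has `dim R/P = 2` exactly. -/
theorem exists_prime_ringKrullDim_quotient_eq_two {R : Type} [CommRing R] [IsNoetherianRing R]
    (J : Ideal R) (hJ : (2 : WithBot ℕ∞) ≤ ringKrullDim (R ⧸ J)) :
    ∃ P : Ideal R, P.IsPrime ∧ J ≤ P ∧ ringKrullDim (R ⧸ P) = 2 := by
  classical
  rw [ringKrullDim_quotient] at hJ
  have hJ' : ((2 : ℕ) : WithBot ℕ∞) ≤ Order.krullDim (PrimeSpectrum.zeroLocus (R := R) J) := by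
    exact_mod_cast hJ
  obtain ⟨l, hl⟩ := Order.le_krullDim_iff.mp hJ'
  let l' : LTSeries (PrimeSpectrum R) := l.map Subtype.val (fun _ _ h => h)
  have hhead : J ≤ (l.head).val.asIdeal := by
    have hmem := (l.head).property
    rw [PrimeSpectrum.mem_zeroLocus] at hmem
    intro x hx
    exact hmem hx
  have hcoht₀ : (2 : ℕ∞) ≤ coheight (l.head).val := by
    have h := Order.length_le_coheight_head (p := l')
    have hlen : l'.length = 2 := by simp [l', hl]
    have hh : l'.head = (l.head).val := by simp [l']
    rw [hlen, hh] at h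
    exact_mod_cast h
  let S : Set (Ideal R) :=
    {I | ∃ y : PrimeSpectrum R, y.asIdeal = I ∧ J ≤ I ∧ (2 : ℕ∞) ≤ coheight y}
  have hSne : S.Nonempty := ⟨_, (l.head).val, rfl, hhead, hcoht₀⟩
  obtain ⟨M, ⟨P, rfl, hJP, hP2⟩, hmax⟩ :=
    set_has_maximal_iff_noetherian.mpr (inferInstance : IsNoetherian R R) S hSne
  refine ⟨P.asIdeal, P.isPrime, hJP, ?_⟩
  have hcoht : coheight P = (2 : ℕ) := by
    rw [Order.coheight_eq_coe_iff_maximal_le_coheight]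
    refine ⟨by exact_mod_cast hP2, fun y hy hPy => ?_⟩
    have hyS : y.asIdeal ∈ S :=
      ⟨y, rfl, hJP.trans ((PrimeSpectrum.asIdeal_le_asIdeal _ _).mpr hPy), by exact_mod_cast hy⟩
    have hnot := hmax y.asIdeal hyS
    by_contra hyP
    refine hnot (lt_of_le_of_ne ((PrimeSpectrum.asIdeal_le_asIdeal _ _).mpr hPy) fun h => hyP ?_)
    exact le_of_eq (PrimeSpectrum.ext h.symm)
  rw [← Literature.AlgebraicGeometry.Dimension.PrimeSpectrum.coe_coheight_eq_ringKrullDim_quotient P,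
    hcoht]
  rfl

/-- THE REGISTERED STUB, VERBATIM STATEMENT, PROVED. -/
theorem stub_stableComponentsModular :
    ∀ (R : Type) [CommRing R] [IsNoetherianRing R] [IsLocalRing R] (I K : Ideal R), K ≤ I →
      (∃ 𝔮 ∈ minimalPrimes R, I ≤ 𝔮) → IsConnectedInDimTwo R →
      (∀ 𝔮₁ ∈ minimalPrimes R, ∀ 𝔮₂ ∈ minimalPrimes R, ¬ I ≤ 𝔮₁ → ¬ I ≤ 𝔮₂ →
        (2 : WithBot ℕ∞) ≤ ringKrullDim (R ⧸ (𝔮₁ ⊔ 𝔮₂)) → K ≤ 𝔮₁ → K ≤ 𝔮₂) →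
      (∀ P : Ideal R, P.IsPrime → I ≤ P → ringKrullDim (R ⧸ P) = 2 →
        ∀ 𝔮 ∈ minimalPrimes R, 𝔮 ≤ P → K ≤ 𝔮) →
      ∀ 𝔮 ∈ minimalPrimes R, K ≤ 𝔮 := by
  intro R _ _ _ I K hKI hyos hconn hgen hht 𝔮 h𝔮
  obtain ⟨𝔮₀, h𝔮₀, hI𝔮₀⟩ := hyos
  by_contra hK𝔮
  let 𝒜 : Set (Ideal R) := {q | q ∈ minimalPrimes R ∧ K ≤ q}
  have h𝒜sub : 𝒜 ⊆ minimalPrimes R := fun q hq => hq.1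
  have h𝒜ne : 𝒜.Nonempty := ⟨𝔮₀, h𝔮₀, hKI.trans hI𝔮₀⟩
  have h𝒜c : (minimalPrimes R \ 𝒜).Nonempty := ⟨𝔮, h𝔮, fun h => hK𝔮 h.2⟩
  obtain ⟨𝔮₁, h𝔮₁, 𝔮₂, h𝔮₂, hdim⟩ := hconn 𝒜 h𝒜sub h𝒜ne h𝒜c
  have h𝔮₂min : 𝔮₂ ∈ minimalPrimes R := h𝔮₂.1
  have hK𝔮₂ : ¬ K ≤ 𝔮₂ := fun h => h𝔮₂.2 ⟨h𝔮₂min, h⟩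
  have hI𝔮₂ : ¬ I ≤ 𝔮₂ := fun h => hK𝔮₂ (hKI.trans h)
  by_cases hI𝔮₁ : I ≤ 𝔮₁
  · obtain ⟨P, hP, hle, hdimP⟩ := exists_prime_ringKrullDim_quotient_eq_two (𝔮₁ ⊔ 𝔮₂) hdim
    exact hK𝔮₂ (hht P hP (hI𝔮₁.trans (le_sup_left.trans hle)) hdimP 𝔮₂ h𝔮₂min
      (le_sup_right.trans hle))
  · exact hK𝔮₂ (hgen 𝔮₁ h𝔮₁.1 𝔮₂ h𝔮₂min hI𝔮₁ hI𝔮₂ hdim h𝔮₁.2)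

end Summit.Langlands.Langlands.Cruxes.ResiduallyYoshidaLifting.StubStableComponentsModular
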